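import Mathlib
import Summits.Ventures.HodgeRepro.Tier4.Common.AdelicDefs
import Summits.Ventures.HodgeRepro.Tier4.Line1.PlaneDefs
import Summits.Ventures.HodgeRepro.Tier4.Line1.CocompactReduction
import Summits.Ventures.HodgeRepro.Tier4.Line1.SigmaCompactGA
import Summits.Ventures.HodgeRepro.Tier4.Line1.CocompactAssembly
import Summits.Ventures.HodgeRepro.Tier4.Line1.AdeleCocompact
import Summits.Ventures.HodgeRepro.Tier4.Line1.WittPlane
import Summits.Ventures.HodgeRepro.Tier4.Line1.AdelicModulus
import Summits.Ventures.HodgeRepro.Tier4.Line1.C7BoxCompact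
import Summits.Ventures.HodgeRepro.Tier4.Line1.C7LocalFibration
import Summits.Ventures.HodgeRepro.Tier4.Line1.C7IntegralTransitive
import Summits.Ventures.HodgeRepro.Tier4.Line1.StabBridge

/-!
# Tier4/Line1/QuotientCompact — (I1-c) and (I1-d) AS TREE THEOREMS: `[U(W)] = U(W)(k)\U(W)(𝔸_k)` is compact and
`U(W)(𝔸_k)` is unimodular, for every genuine definite plane

Blind re-derivation cell `pub-hodge-repro`, Tier 4 (README §9–§10), seat t4-L1-p5 (prover, LINE L1, gen 2).
The one-theorem closure of the R-c chain (`proofs/t4/L1/I1-c-CENSUS.md` §5–§8): the Mostow–Tamagawa assembly C8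
(`cocompact_rationalPoints_of_rungs`, CocompactAssembly) over the landed rungs — C3 «`𝔸_k/k` is compact»
(`exists_compact_add_principal`, AdeleCocompact: C1 StrongApproximation t4-L1-p1 + C2 InfiniteLattice t4-L3-p2),
C5 the adelic modulus (`measure_vecMul_GA`, AdelicModulus, t4-L2-p2; `det B ≠ 0` from `IsDefinite`, C7BoxCompact
t4-L1-p4), C6 Witt for the hermitian plane (`exists_rational_vecMul_eq`, WittPlane, t4-L1-p3), C7 the fibration over
the stabiliser (`exists_compact_stab_mul_of_integral`, C7LocalFibration t4-L1-p4, with local Witt at every place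
(t4-L1-p4, t4-L1-p2) and integral transitivity at almost all places `exists_finset_integral_transitive`
(C7IntegralTransitive, t4-L1-p1)), and `hstab` the cocompactness of the stabiliser of every non-zero rational vector
(`hstab_of_rungs`, StabBridge t4-L1-p3, from the norm-one torus theorem hstab (ii), TorusFujisaki t4-L1-p2 /
NormOneTorus t4-L1-p5).  Then p5-g0's reductions (CocompactReduction, SigmaCompactGA) give the declared (I1-c) and
(I1-d) of Skeleton v0.29 (L639, L7xx) with the ONE disclosed binder `hg : IsGenuineRow W` (with `IsDefinite` alone
they are the junk-plane statements, Borel–Harish-Chandra for an anisotropic orthogonal group).  No printed input is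
consumed anywhere in the chain.

Nothing here says anything about the status of the Hodge conjecture for CM abelian varieties, which is NOT proved
(HC_CM is NOT proved by anyone in this repository).
-/

set_option autoImplicit false

noncomputable section

namespace Summit.Ventures.HodgeRepro.Tier4.Line1

open NumberField MeasureTheory Summit.Ventures.HodgeRepro.Tier4.Common Matrix

variable {k : Type} [Field k] [NumberField k] (W : PlaneData k)

/-- **R-c**: the rational points of a genuine definite plane's unitary group are cocompact in its adelic points —
`U(W)(𝔸_k) = U(W)(k) · C` for a compact `C` (every rung of the Mostow–Tamagawa cut by name). -/
theorem cocompact_rationalPoints (hW : IsDefinite W) (hg : IsGenuineRow W) :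
    ∃ C : Set (GA W), IsCompact C ∧ ∀ g : GA W, ∃ γ : rationalPoints W, ∃ c ∈ C, g = (γ : GA W) * c :=
  cocompact_rationalPoints_of_rungs W (exists_compact_add_principal k)
    (by
      intro _ _ μ _ g S
      exact measure_vecMul_GA W μ (det_ne_zero_of_isDefinite W hW) g S)
    (fun x y hx hy h1 h2 => exists_rational_vecMul_eq W hg hW x y hx hy h1 h2)
    (fun v₀ hv₀ C₀ hC₀ => exists_compact_stab_mul_of_integral W hg hW
      (fun v₀' hv₀' => exists_finset_integral_transitive W hg hW v₀' hv₀') v₀ hv₀ hC₀)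
    (hstab_of_rungs W hW hg)

/-- **(I1-c), with the disclosed binder `hg`**: `[U(W)] = U(W)(k)\U(W)(𝔸_k)` is compact — for every Haar measure a
fundamental domain of the rational points with compact closure exists. -/
theorem quotient_compact_genuine (hW : IsDefinite W) (hg : IsGenuineRow W) [MeasurableSpace (GA W)]
    [BorelSpace (GA W)] (μ : Measure (GA W)) [μ.IsHaarMeasure] :
    ∃ D : Set (GA W), IsFundamentalDomain (rationalPoints W) D μ ∧ IsCompact (closure D) :=
  quotient_compact_of_cocompact W μ (cocompact_rationalPoints W hW hg)

/-- **(I1-d), with the disclosed binder `hg`**: `U(W)(𝔸_k)` is unimodular — every Haar measure is right invariant. -/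
theorem haar_rightInvariant_genuine (hW : IsDefinite W) (hg : IsGenuineRow W) [MeasurableSpace (GA W)]
    [BorelSpace (GA W)] (μ : Measure (GA W)) [μ.IsHaarMeasure] : μ.IsMulRightInvariant :=
  haar_rightInvariant_of_quotient_compact' W μ (quotient_compact_genuine W hW hg μ)

end Summit.Ventures.HodgeRepro.Tier4.Line1

end
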